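import Literature.NumberTheory.Automorphic.UnitaryGroupDetCharacter
import Literature.NumberTheory.Automorphic.UnitaryGroupAdelicDiagSection
import Literature.NumberTheory.Automorphic.UnitaryGroupFormTransport
import Literature.NumberTheory.Automorphic.UnitaryGroupAdelicCharactersDetQuasiSplit
import Literature.NumberTheory.Automorphic.LocalUnitaryGroupCongr
import HarnessLib

/-!
# Every automorphic character of `U(J)(𝔸_F)` trivial on `SU(J)(𝔸_F)` is `ψ ∘ det` — from a section of `det`; the
# hyperbolic plane `J = antidiag(1, 1)` (`U(1,1)`) and the CM case `U(Φ₂)_{L∕L⁺}` with NO residual hypothesis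

Topic `NumberTheory/Automorphic`; namespace `Literature.NumberTheory.Automorphic.UnitaryGroup`.  THEOREMS ONLY (no definition, no
instance, no notation, no named fact, no `sorry`).  Sequel of ★ `UnitaryGroupDetCharacter` (§3 there: the `N = 1` case
`exists_eq_detChar_of_one`, where `det` is inverted by the centre `u ↦ u · 1₁`).

Setting: `E/F` quadratic with non-trivial automorphism `c` (`h2 : [E : F] = 2`, `hc : c ≠ 1`), `J ∈ M_N(E)` with `det J ≠ 0`,
`U(J)(𝔸_F) = UnitaryGroup.adelic F E c N J` (★), `det : U(J)(𝔸_F) →* U(1)(𝔸_F)` (★ `adelicDet`), `ψ ∘ det` (★ `detChar`).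

* §1 **`exists_eq_detChar_of_section`** — if `det` admits a CONTINUOUS HOMOMORPHIC SECTION `sec : U(1)(𝔸_F) →* U(J)(𝔸_F)` carrying
  PRINCIPAL norm-one idèles to RATIONAL points, then every unitary automorphic character `Θ` of `U(J)(𝔸_F)` which kills the
  determinant-one elements is `detChar ψ` for the automorphic character `ψ := Θ ∘ sec` of the norm-one torus `T(𝔸_F)` (read through
  ★ `torusChar`): continuity from `sec`, automorphy from «principal ↦ rational» and `Θ|_{U(J)(F)} = 1`, and `Θ = ψ ∘ det` because
  `g · sec(det g)⁻¹` has determinant `1`.  `detChar` is injective in `ψ` as soon as `det` is onto (`detChar_injective_of_surjective`).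
* §2 **SECTIONS BY CHANGE OF FRAME** (`exists_section_of_formCongr_eq_diagonal`): if a rational frame `B ∈ GL_N(E)` diagonalises `J`
  (`ᵗ(cB) J B = diag d`, ★ `formCongr`), the conjugate `u ↦ B · diag(1, …, u, …, 1) · B⁻¹` of the diagonal section (★ `adelicDiagSection`)
  by the adelic frame `B ⊗ 1` (★ `unitaryGroupOfFormCongrOfEq` over `𝔸_E`, ★ `formCongr_map`) is such a section of `det` on `U(J)(𝔸_F)`.
* §3 **THE HYPERBOLIC PLANE `J₂ = antidiag(1, 1)`** (Mok's `(StdForm.antidiagonal 2).over E`; `U(J₂) = U(1,1)_{E∕F}`): the frame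
  `P = (1 1; 1 −1)` gives `ᵗP̄ J₂ P = diag(2, −2)` (`formCongr_hyperbolicFrame_antidiagonal_two`), hence a section
  `u ↦ P diag(u, 1) P⁻¹ = ½ (u+1, u−1; u−1, u+1)` (`exists_section_antidiagonal_two`) and **`exists_eq_detChar_antidiagonal_two`**.
* §4 **THE CM CASE `F = L⁺`, `E = L`** (`Φ₂ = antidiag(1,1)` in the literal spelling `(i, j) ↦ [i + j + 1 = 2]` of the crux H413 letters,
  ★ `antidiagOne_eq_over`): EVERY unitary automorphic character of `U(Φ₂)(𝔸_{L⁺})` is `cmDetChar L 2 Φ₂ θ` for a (unique) automorphic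
  character `θ` of `U(1)_{L∕L⁺}(𝔸)` — NO residual hypothesis: a continuous character of `U(Φ₂)(𝔸_{L⁺})` kills `SU(Φ₂)(𝔸_{L⁺})`
  automatically (★ `AdelicCharactersDetQuasiSplit.apply_eq_one_of_adelicDet_eq_one`, Dieudonné: `SU` of an isotropic form is generated
  by transvections) (`cm_exists_eq_cmDetChar_of_eq_antidiagonal_two`, **`cm_exists_eq_cmDetChar_antidiagOne_two`**,
  `cm_existsUnique_cmDetChar_antidiagOne_two`); with its local components `Θ|_{U(Φ₂)(L⁺_v)} = θ_v ∘ det` (★ `cmDetChar_inclPlaceAdelic`).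

This is brick (5b) of the in-house road to the LH7 letter O8a `PKsaU2Shape` (crux H413; CENSUS `F0/P3a/F0P3a-p03/g21/CENSUS-O8a-PKsaU2`):
«an automorphic character of `U(Φ₂)(𝔸)` trivial on `SU(Φ₂)(𝔸)` is `θ ∘ det` for an automorphic `θ` of `U(1)`» [Rogawski1990, §13.3 p. 202
«`ξ(h) = η(det₀ h) ψ(det h)`»; GelbartRogawski1991, §3.1 Remark p. 457 L9–13 «regarded as a character of `G`» through `det`].
HC_CM is proved only modulo the printed citations until rung 0 closes; this file moves no count.

## References
* [Rogawski1990] J. D. Rogawski, *Automorphic Representations of Unitary Groups in Three Variables*, Ann. of Math. Stud. 123 (1990), §13.3 p. 202.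
* [GelbartRogawski1991] S. Gelbart, J. Rogawski, Invent. Math. 105 (1991), §3.1 Remark p. 457 L9–13.
* [PlatonovRapinchuk1994] V. Platonov, A. Rapinchuk, *Algebraic Groups and Number Theory* (1994), §2.3 (equivalent forms, conjugate unitary
  groups), §6.2 (the norm-one torus), §7.3 Prop. 7.8.
* [Mok2014] C. P. Mok, Mem. AMS 235 (2015), §1 Notation p. 5 (`J_N`, `det : U(N) → U(1)`).
-/

set_option autoImplicit false

noncomputable section

open NumberField IsDedekindDomain Topology
open Literature.NumberTheory.GaloisRepresentations
open Literature.NumberTheory.Automorphic.Arthur2013.Leaves.TECR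
open scoped MatrixGroups

namespace Literature.NumberTheory.Automorphic

namespace UnitaryGroup

/-- A homomorphism `φ : G →* Mˣ` is continuous as soon as `g ↦ (φ g : M)` is (private copy of the root-level lemma of ★
`GLOneStandardLTate`, as in ★ `UnitaryGroupDetCharacter`). [folklore] -/
private theorem continuous_units_of_continuous_val₂ {G M : Type*} [Group G] [TopologicalSpace G] [ContinuousInv G] [Monoid M]
    [TopologicalSpace M] (φ : G →* Mˣ) (h : Continuous fun g => (φ g : M)) : Continuous φ := by
  refine Units.continuous_iff.mpr ⟨h, (h.comp continuous_inv).congr fun g => ?_⟩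
  simp only [Function.comp_apply, map_inv]

section Quadratic

variable (F E : Type) [Field F] [NumberField F] [Field E] [NumberField E] [Algebra F E] (c : E ≃ₐ[F] E)
  (h2 : Module.finrank F E = 2) (hc : c ≠ 1) (N : ℕ) (J : Matrix (Fin N) (Fin N) E)

/-! ## §1 From a section of `det` to `Θ = ψ ∘ det` -/

include h2 hc in
/-- **Every unitary automorphic character of `U(J)(𝔸_F)` trivial on `SU(J)(𝔸_F)` is `ψ ∘ det`**, as soon as `det : U(J)(𝔸_F) → U(1)(𝔸_F)`
has a continuous homomorphic section `sec` carrying principal norm-one idèles to rational points: `ψ := Θ ∘ sec` read on the norm-one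
torus `T(𝔸_F)` (★ `torusChar`) is continuous, automorphic (a principal `u` has `sec u ∈ U(J)(F)` where `Θ = 1`), and `Θ = ψ ∘ det`
because `g · sec(det g)⁻¹ ∈ SU(J)(𝔸_F)`.  The `N = 1` case (section = centre) is ★ `exists_eq_detChar_of_one`.
[cite: GelbartRogawski1991, §3.1 Remark p. 457 L9–13] [cite: Rogawski1990, §13.3 p. 202] -/
theorem exists_eq_detChar_of_section (hJ : J.det ≠ 0) (sec : adelicOne F E c →* adelic F E c N J)
    (hsec : ∀ u, adelicDet F E c N J hJ (sec u) = u) (hcont : Continuous sec)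
    (hrat : ∀ u : adelicOne F E c, ((u : (AdeleRing (𝓞 E) E)ˣ) : ideleGroup E) ∈ principalIdeles E → sec u ∈ (toAdelic F E c N J).range)
    (Θ : (adelicGroupData F E c N J).AutomorphicCharacter)
    (hΘ : ∀ g : (adelicGroupData F E c N J).Adelic, adelicDet F E c N J hJ g = 1 → Θ g = 1) :
    ∃ (ψ : ↥(TorusDict.torus c) →ₜ* ℂˣ) (hψ : TorusDict.IsAutomorphic c ψ), detChar F E c h2 hc N J ψ hψ hJ = Θ := by
  -- `α := Θ ∘ sec : U(1)(𝔸_F) →* ℂˣ`, continuous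
  set α : adelicOne F E c →* ℂˣ := Θ.toMonoidHom.comp sec with hα_def
  have hαc : Continuous α := continuous_units_of_continuous_val₂ α (Θ.continuous.comp hcont)
  -- automorphy: a principal norm-one idèle `u` has `sec u` RATIONAL, where `Θ = 1`
  have hαaut : ∀ u : adelicOne F E c, ((u : (AdeleRing (𝓞 E) E)ˣ) : ideleGroup E) ∈ principalIdeles E → α u = 1 := by
    intro u hu
    obtain ⟨γ, hγ⟩ := hrat u hu
    change Θ (sec u) = 1
    rw [← hγ]
    exact Θ.map_of_mem ((mem_quotientSubgroup_adelicGroupData_iff F E c N J _).2 ⟨γ, rfl⟩)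
  refine ⟨torusChar F E c α hαc, (isAutomorphic_torusChar_iff F E c α hαc).2 hαaut, DFunLike.ext _ _ fun g => ?_⟩
  change adelicOneChar F E c (torusChar F E c α hαc) (adelicDet F E c N J hJ g) = Θ g
  rw [adelicOneChar_torusChar]
  change Θ (sec (adelicDet F E c N J hJ g)) = Θ g
  -- read `Θ` as a homomorphism on the subgroup `U(J)(𝔸_F) ≤ GL_N(𝔸_E)` (same object; aligns the `Mul` instances)
  let Θ' : adelic F E c N J →* ℂˣ := Θ.toMonoidHom
  have hΘ' : ∀ x : adelic F E c N J, adelicDet F E c N J hJ x = 1 → Θ' x = 1 := fun x hx => hΘ x hx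
  -- `g · sec(det g)⁻¹` has determinant one
  have h1 : adelicDet F E c N J hJ (@id (adelic F E c N J) g * (sec (adelicDet F E c N J hJ g))⁻¹) = 1 := by
    rw [map_mul, map_inv, hsec]
    exact mul_inv_cancel _
  have h3 := hΘ' _ h1
  rw [map_mul, map_inv, mul_inv_eq_one] at h3
  exact h3.symm

include h2 hc in
/-- **`ψ ↦ ψ ∘ det` is injective when `det : U(J)(𝔸_F) → U(1)(𝔸_F)` is onto** (e.g. when it has a section): the automorphic `ψ` with
`Θ = ψ ∘ det` is unique. [cite: GelbartRogawski1991, §3.1 Remark p. 457 L9–13] -/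
theorem detChar_injective_of_surjective (hJ : J.det ≠ 0) (hdet : Function.Surjective (adelicDet F E c N J hJ))
    {ψ ψ' : ↥(TorusDict.torus c) →ₜ* ℂˣ} {hψ : TorusDict.IsAutomorphic c ψ} {hψ' : TorusDict.IsAutomorphic c ψ'}
    (h : detChar F E c h2 hc N J ψ hψ hJ = detChar F E c h2 hc N J ψ' hψ' hJ) : ψ = ψ' := by
  refine ContinuousMonoidHom.ext fun t => ?_
  obtain ⟨u, rfl⟩ := (adelicOneEquivTorus F E c).surjective t
  obtain ⟨g, rfl⟩ := hdet u
  rw [← detChar_apply F E c h2 hc N J ψ hψ hJ g, ← detChar_apply F E c h2 hc N J ψ' hψ' hJ g, h]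

include h2 hc in
/-- **Existence and uniqueness together**: under the hypotheses of `exists_eq_detChar_of_section` there is EXACTLY ONE automorphic `ψ` of
the norm-one torus with `Θ = ψ ∘ det` (as a subtype-valued `∃!` on the pair `⟨ψ, hψ⟩`). [cite: GelbartRogawski1991, §3.1 Remark p. 457 L9–13] -/
theorem existsUnique_eq_detChar_of_section (hJ : J.det ≠ 0) (sec : adelicOne F E c →* adelic F E c N J)
    (hsec : ∀ u, adelicDet F E c N J hJ (sec u) = u) (hcont : Continuous sec)
    (hrat : ∀ u : adelicOne F E c, ((u : (AdeleRing (𝓞 E) E)ˣ) : ideleGroup E) ∈ principalIdeles E → sec u ∈ (toAdelic F E c N J).range)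
    (Θ : (adelicGroupData F E c N J).AutomorphicCharacter)
    (hΘ : ∀ g : (adelicGroupData F E c N J).Adelic, adelicDet F E c N J hJ g = 1 → Θ g = 1) :
    ∃! ψa : {ψ : ↥(TorusDict.torus c) →ₜ* ℂˣ // TorusDict.IsAutomorphic c ψ}, detChar F E c h2 hc N J ψa.1 ψa.2 hJ = Θ := by
  obtain ⟨ψ, hψ, hΘψ⟩ := exists_eq_detChar_of_section F E c h2 hc N J hJ sec hsec hcont hrat Θ hΘ
  refine ⟨⟨ψ, hψ⟩, hΘψ, fun ψa hψa => Subtype.ext ?_⟩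
  exact detChar_injective_of_surjective F E c h2 hc N J hJ (fun u => ⟨sec u, hsec u⟩) (hψa.trans hΘψ.symm)

/-! ## §2 Sections of `det` by change of frame: `u ↦ B · diag(1, …, u, …, 1) · B⁻¹` -/

omit [NumberField F] in
/-- **A rational frame diagonalising `J` gives a section of `det` on `U(J)(𝔸_F)`**: if `ᵗ(cB) J B = diag d` for `B ∈ GL_N(E)` then
`u ↦ (B ⊗ 1) · diag(1, …, u, …, 1) · (B ⊗ 1)⁻¹` (slot `i`; ★ `adelicDiagSection` conjugated by the adelic frame along ★ `unitaryGroupOfFormCongrOfEq`)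
is a continuous homomorphic section of `det : U(J)(𝔸_F) →* U(1)(𝔸_F)` carrying principal norm-one idèles to rational points
(`B · diag(1, …, x, …, 1) · B⁻¹ ∈ U(J)(F)` for `x ∈ E¹`). [cite: PlatonovRapinchuk1994, §2.3] [cite: Mok2014, §1 Notation p. 5] -/
theorem exists_section_of_formCongr_eq_diagonal (B : GL (Fin N) E) (d : Fin N → E) (h : formCongr (c : E →+* E) B J = Matrix.diagonal d)
    (hJ : J.det ≠ 0) (i : Fin N) :
    ∃ sec : adelicOne F E c →* adelic F E c N J,
      (∀ u, adelicDet F E c N J hJ (sec u) = u) ∧ Continuous sec ∧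
        ∀ u : adelicOne F E c, ((u : (AdeleRing (𝓞 E) E)ˣ) : ideleGroup E) ∈ principalIdeles E → sec u ∈ (toAdelic F E c N J).range := by
  -- the adelic frame `T = B ⊗ 1 ∈ GL_N(𝔸_E)` diagonalises `J ⊗ 1`
  set T : GL (Fin N) (AdeleRing (𝓞 E) E) := Matrix.GeneralLinearGroup.map (algebraMap E (AdeleRing (𝓞 E) E)) B with hT
  have hform : formCongr (conjAdele F E c) T (adelicForm E N J) = adelicForm E N (Matrix.diagonal d) := by
    rw [adelicForm, adelicForm, hT, ← formCongr_map (c : E →+* E) (algebraMap E (AdeleRing (𝓞 E) E)) (algebraMap_conj F E c), h]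
  -- `e : U(diag d)(𝔸_F) ≃ₜ* U(J)(𝔸_F)`, `g ↦ T g T⁻¹`
  let e : adelic F E c N (Matrix.diagonal d) ≃ₜ* adelic F E c N J :=
    unitaryGroupOfFormCongrOfEq (conjAdele F E c) T (adelicForm E N J) (adelicForm E N (Matrix.diagonal d)) hform
  have he : ∀ x : adelic F E c N (Matrix.diagonal d),
      ((e x : adelic F E c N J) : GL (Fin N) (AdeleRing (𝓞 E) E)) = T * (x : GL (Fin N) (AdeleRing (𝓞 E) E)) * T⁻¹ := fun x => rfl
  refine ⟨e.toMulEquiv.toMonoidHom.comp (adelicDiagSection F E c N d i), fun u => ?_, ?_, fun u hu => ?_⟩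
  · -- `det (T x T⁻¹) = det x = u`
    apply Subtype.ext
    rw [coe_adelicDet]
    change Matrix.GeneralLinearGroup.det ((e (adelicDiagSection F E c N d i u) : adelic F E c N J) : GL (Fin N) (AdeleRing (𝓞 E) E)) = _
    rw [he, map_mul, map_mul, map_inv, mul_inv_cancel_comm, det_coe_adelicDiagSection]
  · exact e.continuous.comp (continuous_adelicDiagSection F E c N d i)
  · -- principal `u = (x)`: `diag(1, …, u, …, 1) = γ ⊗ 1` with `γ ∈ U(diag d)(F)`, and `B γ B⁻¹ ∈ U(J)(F)`
    obtain ⟨γ, hγ⟩ := adelicDiagSection_mem_range_toAdelic F E c N d i u hu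
    have hγmem : B * (γ : GL (Fin N) E) * B⁻¹ ∈ rational F E c N J := by
      refine (conj_mem_unitaryGroupOfForm_iff (c : E →+* E) B J (γ : GL (Fin N) E)).2 ?_
      rw [h]
      exact γ.2
    refine ⟨⟨_, hγmem⟩, Subtype.ext ?_⟩
    change Matrix.GeneralLinearGroup.map (algebraMap E (AdeleRing (𝓞 E) E)) (B * (γ : GL (Fin N) E) * B⁻¹) =
      ((e (adelicDiagSection F E c N d i u) : adelic F E c N J) : GL (Fin N) (AdeleRing (𝓞 E) E))
    rw [he, map_mul, map_mul, map_inv, ← hγ]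
    rfl

include h2 hc in
/-- **`Θ = ψ ∘ det` on `U(J)(𝔸_F)` for a form diagonalised by a rational frame** (`ᵗ(cB) J B = diag d`): every unitary automorphic
character of `U(J)(𝔸_F)` trivial on `SU(J)(𝔸_F)` is `detChar ψ` for an automorphic `ψ` of the norm-one torus (§1 + §2).
[cite: GelbartRogawski1991, §3.1 Remark p. 457 L9–13] [cite: PlatonovRapinchuk1994, §2.3] -/
theorem exists_eq_detChar_of_formCongr_eq_diagonal [NeZero N] (B : GL (Fin N) E) (d : Fin N → E)
    (h : formCongr (c : E →+* E) B J = Matrix.diagonal d) (hJ : J.det ≠ 0)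
    (Θ : (adelicGroupData F E c N J).AutomorphicCharacter)
    (hΘ : ∀ g : (adelicGroupData F E c N J).Adelic, adelicDet F E c N J hJ g = 1 → Θ g = 1) :
    ∃ (ψ : ↥(TorusDict.torus c) →ₜ* ℂˣ) (hψ : TorusDict.IsAutomorphic c ψ), detChar F E c h2 hc N J ψ hψ hJ = Θ := by
  obtain ⟨sec, hsec, hcont, hrat⟩ := exists_section_of_formCongr_eq_diagonal F E c N J B d h hJ 0
  exact exists_eq_detChar_of_section F E c h2 hc N J hJ sec hsec hcont hrat Θ hΘ

include h2 hc in
/-- **The diagonal case** `J = diag d` (frame `B = 1`, section ★ `adelicDiagSection` itself): every unitary automorphic character of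
`U(diag d)(𝔸_F)` trivial on `SU(diag d)(𝔸_F)` is `ψ ∘ det`. [cite: GelbartRogawski1991, §3.1 Remark p. 457 L9–13] [cite: Mok2014, §1 Notation p. 5] -/
theorem exists_eq_detChar_of_diagonal [NeZero N] (d : Fin N → E) (hd : (Matrix.diagonal d).det ≠ 0)
    (Θ : (adelicGroupData F E c N (Matrix.diagonal d)).AutomorphicCharacter)
    (hΘ : ∀ g : (adelicGroupData F E c N (Matrix.diagonal d)).Adelic, adelicDet F E c N (Matrix.diagonal d) hd g = 1 → Θ g = 1) :
    ∃ (ψ : ↥(TorusDict.torus c) →ₜ* ℂˣ) (hψ : TorusDict.IsAutomorphic c ψ), detChar F E c h2 hc N (Matrix.diagonal d) ψ hψ hd = Θ :=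
  exists_eq_detChar_of_section F E c h2 hc N (Matrix.diagonal d) hd (adelicDiagSection F E c N d 0)
    (fun u => adelicDet_adelicDiagSection F E c N d 0 hd u) (continuous_adelicDiagSection F E c N d 0)
    (fun u hu => adelicDiagSection_mem_range_toAdelic F E c N d 0 u hu) Θ hΘ

/-! ## §3 The hyperbolic plane `J₂ = antidiag(1, 1)`: the frame `P = (1 1; 1 −1)` and the section `u ↦ P diag(u, 1) P⁻¹` -/

omit [NumberField F] [Algebra F E] in
/-- `det (1 1; 1 −1) = −2 ≠ 0` over the number field `E` (characteristic `0`): the hyperbolic frame `P = (1 1; 1 −1)` is a change of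
basis. [cite: PlatonovRapinchuk1994, §2.3] -/
theorem det_hyperbolicFrame_ne_zero : (!![(1 : E), 1; 1, -1]).det ≠ 0 := by
  rw [Matrix.det_fin_two_of]
  norm_num

omit [NumberField F] in
/-- **`ᵗP̄ · antidiag(1,1) · P = diag(2, −2)` for the hyperbolic frame `P = (1 1; 1 −1)`** (`P̄ = P`: its entries are `±1`; Mok's
`J₂ = (StdForm.antidiagonal 2).over E = antidiag(1, 1)`): the hyperbolic plane is the orthogonal sum of the lines `⟨2⟩ ⊥ ⟨−2⟩`.
[cite: PlatonovRapinchuk1994, §2.3] [cite: Mok2014, §1 Notation p. 5] -/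
theorem formCongr_hyperbolicFrame_antidiagonal_two :
    formCongr (c : E →+* E) (Matrix.GeneralLinearGroup.mkOfDetNeZero _ (det_hyperbolicFrame_ne_zero E))
      ((StdForm.antidiagonal 2).over E) = Matrix.diagonal ![(2 : E), -2] := by
  have hB : ((Matrix.GeneralLinearGroup.mkOfDetNeZero _ (det_hyperbolicFrame_ne_zero E) : GL (Fin 2) E) : Matrix (Fin 2) (Fin 2) E) =
      !![(1 : E), 1; 1, -1] := rfl
  have hBc : (!![(1 : E), 1; 1, -1]).map (c : E →+* E) = !![(1 : E), 1; 1, -1] := by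
    ext i j
    fin_cases i <;> fin_cases j <;> simp
  have hA : (StdForm.antidiagonal 2).over E = !![(0 : E), 1; 1, 0] := by
    ext i j
    fin_cases i <;> fin_cases j <;> simp [StdForm.over, StdForm.antidiagonal_J_apply]
  dsimp only [formCongr]
  rw [hB, hBc, hA]
  ext i j
  fin_cases i <;> fin_cases j <;> simp [Matrix.mul_apply, Fin.sum_univ_two] <;> norm_num

omit [NumberField F] in
/-- **`det : U(1,1)(𝔸_F) → U(1)(𝔸_F)` has a continuous homomorphic section carrying principal idèles to rational points** — for Mok's
`J₂ = antidiag(1, 1)`: `u ↦ P · diag(u, 1) · P⁻¹ = ½ (u+1, u−1; u−1, u+1)` (§2 with the hyperbolic frame); in particular `det` is ONTO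
`U(1)(𝔸_F)` on `U(1,1)(𝔸_F)`. [cite: PlatonovRapinchuk1994, §2.3] [cite: Mok2014, §1 Notation p. 5] -/
theorem exists_section_antidiagonal_two (hJ : ((StdForm.antidiagonal 2).over E).det ≠ 0) :
    ∃ sec : adelicOne F E c →* adelic F E c 2 ((StdForm.antidiagonal 2).over E),
      (∀ u, adelicDet F E c 2 ((StdForm.antidiagonal 2).over E) hJ (sec u) = u) ∧ Continuous sec ∧
        ∀ u : adelicOne F E c, ((u : (AdeleRing (𝓞 E) E)ˣ) : ideleGroup E) ∈ principalIdeles E →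
          sec u ∈ (toAdelic F E c 2 ((StdForm.antidiagonal 2).over E)).range :=
  exists_section_of_formCongr_eq_diagonal F E c 2 ((StdForm.antidiagonal 2).over E) _ _
    (formCongr_hyperbolicFrame_antidiagonal_two F E c) hJ 0

omit [NumberField F] in
/-- `det : U(1,1)(𝔸_F) →* U(1)(𝔸_F)` is surjective for `J₂ = antidiag(1, 1)`. [cite: Mok2014, §1 Notation p. 5] -/
theorem adelicDet_surjective_antidiagonal_two (hJ : ((StdForm.antidiagonal 2).over E).det ≠ 0) :
    Function.Surjective (adelicDet F E c 2 ((StdForm.antidiagonal 2).over E) hJ) := by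
  obtain ⟨sec, hsec, -, -⟩ := exists_section_antidiagonal_two F E c hJ
  exact fun u => ⟨sec u, hsec u⟩

include h2 hc in
/-- **Every unitary automorphic character of `U(1,1)(𝔸_F) = U(antidiag(1,1))(𝔸_F)` trivial on `SU(1,1)(𝔸_F)` is `ψ ∘ det`** for an
automorphic `ψ` of the norm-one torus `T = U(1)_{E∕F}`. [cite: GelbartRogawski1991, §3.1 Remark p. 457 L9–13] [cite: Rogawski1990, §13.3 p. 202] -/
theorem exists_eq_detChar_antidiagonal_two (hJ : ((StdForm.antidiagonal 2).over E).det ≠ 0)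
    (Θ : (adelicGroupData F E c 2 ((StdForm.antidiagonal 2).over E)).AutomorphicCharacter)
    (hΘ : ∀ g : (adelicGroupData F E c 2 ((StdForm.antidiagonal 2).over E)).Adelic,
      adelicDet F E c 2 ((StdForm.antidiagonal 2).over E) hJ g = 1 → Θ g = 1) :
    ∃ (ψ : ↥(TorusDict.torus c) →ₜ* ℂˣ) (hψ : TorusDict.IsAutomorphic c ψ),
      detChar F E c h2 hc 2 ((StdForm.antidiagonal 2).over E) ψ hψ hJ = Θ := by
  obtain ⟨sec, hsec, hcont, hrat⟩ := exists_section_antidiagonal_two F E c hJ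
  exact exists_eq_detChar_of_section F E c h2 hc 2 _ hJ sec hsec hcont hrat Θ hΘ

end Quadratic

/-! ## §4 The CM case `E = L`, `F = L⁺`: every automorphic character of `U(Φ₂)(𝔸_{L⁺})` is `θ ∘ det`, no residual hypothesis -/

section CM

variable (L : Type) [Field L] [NumberField L] [IsCMField L]

/-- **Every unitary automorphic character of the quasi-split `U(Φ)(𝔸_{L⁺})`, `Φ = antidiag(1,1)` (any spelling `Φ = (StdForm.antidiagonal 2).over L`),
is `cmDetChar L 2 Φ θ` for an automorphic character `θ` of `U(1)_{L∕L⁺}(𝔸)`** — NO residual hypothesis: a continuous character of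
`U(Φ)(𝔸_{L⁺})` kills the determinant-one elements (★ `AdelicCharactersDetQuasiSplit.apply_eq_one_of_adelicDet_eq_one`: `SU(1,1)` is
generated by transvections at every place, [Dieudonne1971GroupesClassiques, Chap. II §5]), and §3 supplies the section of `det`.
[cite: Rogawski1990, §13.3 p. 202] [cite: GelbartRogawski1991, §3.1 Remark p. 457 L9–13] -/
theorem cm_exists_eq_cmDetChar_of_eq_antidiagonal_two (Φ : Matrix (Fin 2) (Fin 2) L) (hΦ : Φ = (StdForm.antidiagonal 2).over L)
    (hΦd : Φ.det ≠ 0)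
    (Θ : (adelicGroupData ↥(maximalRealSubfield L) L (IsCMField.complexConj L) 2 Φ).AutomorphicCharacter) :
    ∃ (θ : ↥(TorusDict.torus (IsCMField.complexConj L)) →ₜ* ℂˣ) (hθ : TorusDict.IsAutomorphic (IsCMField.complexConj L) θ),
      cmDetChar L 2 Φ θ hθ hΦd = Θ := by
  subst hΦ
  refine exists_eq_detChar_antidiagonal_two ↥(maximalRealSubfield L) L (IsCMField.complexConj L)
    (Algebra.IsQuadraticExtension.finrank_eq_two _ L) (IsCMField.complexConj_ne_one (K := L)) hΦd Θ fun g hg => ?_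
  exact AdelicCharactersDetQuasiSplit.apply_eq_one_of_adelicDet_eq_one L (le_refl 2) hΦd Θ.toMonoidHom
    (continuous_units_of_continuous_val₂ Θ.toMonoidHom Θ.continuous) g hg

/-- Uniqueness in the CM case: `θ ↦ cmDetChar L 2 Φ θ` is injective for `Φ = antidiag(1,1)` (`det` is onto, §3).
[cite: GelbartRogawski1991, §3.1 Remark p. 457 L9–13] -/
theorem cm_cmDetChar_injective_of_eq_antidiagonal_two (Φ : Matrix (Fin 2) (Fin 2) L) (hΦ : Φ = (StdForm.antidiagonal 2).over L)
    (hΦd : Φ.det ≠ 0) {θ θ' : ↥(TorusDict.torus (IsCMField.complexConj L)) →ₜ* ℂˣ}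
    {hθ : TorusDict.IsAutomorphic (IsCMField.complexConj L) θ} {hθ' : TorusDict.IsAutomorphic (IsCMField.complexConj L) θ'}
    (h : cmDetChar L 2 Φ θ hθ hΦd = cmDetChar L 2 Φ θ' hθ' hΦd) : θ = θ' := by
  subst hΦ
  exact detChar_injective_of_surjective ↥(maximalRealSubfield L) L (IsCMField.complexConj L)
    (Algebra.IsQuadraticExtension.finrank_eq_two _ L) (IsCMField.complexConj_ne_one (K := L)) 2 _ hΦd
    (adelicDet_surjective_antidiagonal_two ↥(maximalRealSubfield L) L (IsCMField.complexConj L) hΦd) h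

/-- **THE LH7∕O8a CURRENCY (crux H413): every unitary automorphic character `Θ` of `U(Φ₂)(𝔸_{L⁺})`, `Φ₂ = antidiag(1,1)` in the literal
spelling `(i, j) ↦ [i + j + 1 = 2]` of the H413 letters (★ `antidiagOne_eq_over`, ★ `isUnit_antidiagOne_det`), is `cmDetChar L 2 Φ₂ θ hθ _` for an
automorphic character `θ` of `U(1)_{L∕L⁺}(𝔸)`** — hence `Θ|_{U(Φ₂)(L⁺_v)} = θ_v ∘ det` at every finite `v` (★ `cmDetChar_inclPlaceAdelic`).
«`ξ(h) = η(det₀ h) ψ(det h)`»: a character of `U(2)` IS a character of `U(1)` through `det`. [cite: Rogawski1990, §13.3 p. 202]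
[cite: GelbartRogawski1991, §3.1 Remark p. 457 L9–13] -/
theorem cm_exists_eq_cmDetChar_antidiagOne_two
    (Θ : (adelicGroupData ↥(maximalRealSubfield L) L (IsCMField.complexConj L) 2
      (Matrix.of fun i j : Fin 2 => if i.val + j.val + 1 = 2 then (1 : L) else 0)).AutomorphicCharacter) :
    ∃ (θ : ↥(TorusDict.torus (IsCMField.complexConj L)) →ₜ* ℂˣ) (hθ : TorusDict.IsAutomorphic (IsCMField.complexConj L) θ),
      cmDetChar L 2 (Matrix.of fun i j : Fin 2 => if i.val + j.val + 1 = 2 then (1 : L) else 0) θ hθ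
        (isUnit_antidiagOne_det L 2).ne_zero = Θ :=
  cm_exists_eq_cmDetChar_of_eq_antidiagonal_two L _ (antidiagOne_eq_over L 2) _ Θ

/-- Uniqueness in the LH7∕O8a currency: the automorphic `θ` with `Θ = cmDetChar L 2 Φ₂ θ hθ _` is unique. [cite: GelbartRogawski1991, §3.1 Remark p. 457 L9–13] -/
theorem cm_cmDetChar_injective_antidiagOne_two {θ θ' : ↥(TorusDict.torus (IsCMField.complexConj L)) →ₜ* ℂˣ}
    {hθ : TorusDict.IsAutomorphic (IsCMField.complexConj L) θ} {hθ' : TorusDict.IsAutomorphic (IsCMField.complexConj L) θ'}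
    (h : cmDetChar L 2 (Matrix.of fun i j : Fin 2 => if i.val + j.val + 1 = 2 then (1 : L) else 0) θ hθ (isUnit_antidiagOne_det L 2).ne_zero =
      cmDetChar L 2 (Matrix.of fun i j : Fin 2 => if i.val + j.val + 1 = 2 then (1 : L) else 0) θ' hθ' (isUnit_antidiagOne_det L 2).ne_zero) :
    θ = θ' :=
  cm_cmDetChar_injective_of_eq_antidiagonal_two L _ (antidiagOne_eq_over L 2) _ h

/-- **Existence AND uniqueness in the LH7∕O8a currency**, as a subtype-valued `∃!` on the pair `⟨θ, hθ⟩`. [cite: Rogawski1990, §13.3 p. 202]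
[cite: GelbartRogawski1991, §3.1 Remark p. 457 L9–13] -/
theorem cm_existsUnique_cmDetChar_antidiagOne_two
    (Θ : (adelicGroupData ↥(maximalRealSubfield L) L (IsCMField.complexConj L) 2
      (Matrix.of fun i j : Fin 2 => if i.val + j.val + 1 = 2 then (1 : L) else 0)).AutomorphicCharacter) :
    ∃! θa : {θ : ↥(TorusDict.torus (IsCMField.complexConj L)) →ₜ* ℂˣ // TorusDict.IsAutomorphic (IsCMField.complexConj L) θ},
      cmDetChar L 2 (Matrix.of fun i j : Fin 2 => if i.val + j.val + 1 = 2 then (1 : L) else 0) θa.1 θa.2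
        (isUnit_antidiagOne_det L 2).ne_zero = Θ := by
  obtain ⟨θ, hθ, hΘθ⟩ := cm_exists_eq_cmDetChar_antidiagOne_two L Θ
  refine ⟨⟨θ, hθ⟩, hΘθ, fun θa hθa => Subtype.ext ?_⟩
  exact cm_cmDetChar_injective_antidiagOne_two L (hθa.trans hΘθ.symm)

/-- **Local components, LH7 reading**: for every unitary automorphic character `Θ` of `U(Φ₂)(𝔸_{L⁺})` there is an automorphic `θ` of
`U(1)_{L∕L⁺}(𝔸)` with `Θ (ι_v k) = θ_v (det k)` for every finite place `v` and every `k ∈ U(Φ₂)(L⁺_v)` (Π-model, ★ `inclPlaceAdelic`,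
★ `torusLocalComponent`, ★ `localDet`, ★ `localPiEquiv`) — the shape in which O8a `PKsaU2Shape` consumes (5b). [cite: Rogawski1990, §12.2 pp. 173–174; §13.3 p. 202] -/
theorem cm_exists_forall_inclPlaceAdelic_eq_torusLocalComponent_localDet_antidiagOne_two
    (Θ : (adelicGroupData ↥(maximalRealSubfield L) L (IsCMField.complexConj L) 2
      (Matrix.of fun i j : Fin 2 => if i.val + j.val + 1 = 2 then (1 : L) else 0)).AutomorphicCharacter) :
    ∃ (θ : ↥(TorusDict.torus (IsCMField.complexConj L)) →ₜ* ℂˣ) (_ : TorusDict.IsAutomorphic (IsCMField.complexConj L) θ),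
      ∀ (v : HeightOneSpectrum (𝓞 ↥(maximalRealSubfield L)))
        (k : localPi L (IsCMField.complexConj L) 2 (Matrix.of fun i j : Fin 2 => if i.val + j.val + 1 = 2 then (1 : L) else 0) v),
        Θ (inclPlaceAdelic ↥(maximalRealSubfield L) L (IsCMField.complexConj L) 2
            (Matrix.of fun i j : Fin 2 => if i.val + j.val + 1 = 2 then (1 : L) else 0) v k) =
          torusLocalComponent L (IsCMField.complexConj L) v θ
            (localDet (IsCMField.complexConj L) v (isUnit_antidiagOne_det L 2)
              (localPiEquiv L (IsCMField.complexConj L) 2 (Matrix.of fun i j : Fin 2 => if i.val + j.val + 1 = 2 then (1 : L) else 0) v k)) := by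
  obtain ⟨θ, hθ, hΘθ⟩ := cm_exists_eq_cmDetChar_antidiagOne_two L Θ
  refine ⟨θ, hθ, fun v k => ?_⟩
  rw [← hΘθ]
  exact cmDetChar_inclPlaceAdelic L 2 _ θ hθ _ v k

end CM

end UnitaryGroup

end Literature.NumberTheory.Automorphic

end
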